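import Summits.BirchSwinnertonDyer.BirchSwinnertonDyer.Theorems.GenusKolyvaginAtTwoEquivariantKolyvaginExactAtTwoKolyvaginPrimeDictionary
import Summits.BirchSwinnertonDyer.BirchSwinnertonDyer.Theorems.GenusKolyvaginAtTwoEquivariantKolyvaginExactAtTwoTwistLocalConditions
import HarnessLib

/-!
# Route `GenusKolyvaginAtTwo`, LINE 6, KEY crux Q3 (inner statement of stmt-BirchSwinnertonDyer-22137):
# McCallum's Prop. 4.4 OVER `ℚ` for the pair `(E, E^{(c)})` from the Kolyvagin relation OVER `K`
# (Q2 `KolyvaginRelationAtTwo`) — fields `c_mem_loc_iff₁₂` / `c_mem_loc_iff₂₁` of gk2-p2's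
# `KolyvaginDescent.VisiblePairHypothesesM` (p632473)

Helper (seat `bsd-line-gk2-p3` g12; `--supports` the crux, closes nothing). The Kolyvagin relation at `2`
(McCallum 1991 Prop. 4.4; the route's Q2, stmt-24880) is a statement over the Heegner field `K` at the inert
place `λ ∣ ℓ`: for the `K`-classes `c_K(m)`, `c_K(ℓm) ∈ H¹(K, E_K[q])`, `q = 2^M`, and a multiplier `c'`
(`= 2^j`), **`c'·c_K(ℓm)` is Selmer at `λ` iff `c'·c_K(m)` vanishes at `λ`**. The pair descent of LINE 6
runs over `ℚ` on `V₁ = H¹(ℚ, E[q])` (even depth) and `V₂ = H¹(ℚ, E^{(c)}[q])` (odd depth), the classes being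
the DESCENDED ones: `res u = c_K(m)` (even depth, this lineage's `…EigenClassesFinite`) and
`hPsiKT (res y) = c_K(ℓm)` (odd depth, through `E^{(c)}_K ≅ E_K`). This file moves Prop. 4.4 down:

* `zsmul_mem_selmerLocalKer_iff_resTorsion` — at an odd good place `v ∤ c₀ n` of `ℚ` (unramified in
  `K = ℚ(θ₀)`, `θ₀² = c₀ ∈ ℤ`), `w ∣ v`: **`c'·x` is Selmer at `v` iff `c'·res x` is Selmer at `w`**
  (`resTorsion_mem_selmerLocalKer` + `mem_selmerLocalKer_of_resTorsion_mem_quadratic` of this lineage);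
* `zsmul_twist_mem_selmerLocalKer_iff_zsmul_mem_torsionLocalKer_of_K` — **field `c_mem_loc_iff₁₂`**: at a
  Gross–Kolyvagin prime `ℓ` (odd, good for `E` and `E^{(c)}`, `ℓ ∤ c₀`, `λ ∣ ℓ` of residue degree `2`,
  `Frob_ℓ ∼ τ` on `E[q]`, `Δ(E) < 0`), from the `K`-relation for `(c_K(m), c_K(ℓm))`:
  `c'·y ∈ selmerLocalKer_ℓ(E^{(c)}/ℚ) ⟺ c'·u ∈ torsionLocalKer_ℓ(E/ℚ)`;
* `zsmul_mem_selmerLocalKer_iff_zsmul_twist_mem_torsionLocalKer_of_K` — **field `c_mem_loc_iff₂₁`**: the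
  same from odd depth `m` to even depth `ℓm` (`res u' = c_K(ℓm)`, `hPsiKT (res y') = c_K(m)`), with the
  dictionary applied to the twin (`Δ(E^{(c)}) < 0`, `Frob_ℓ ∼ τ` on `E^{(c)}[q]` — both supplied from `E` by
  `…TwinGrossPrimes` for `c = d_K`).

Ingredients: the transfer above, `zsmul_mem_selmerLocalKer_iff_hPsiKT_mem` / `zsmul_mem_torsionLocalKer_iff_hPsiKT_mem`
(`…TwistLocalConditions`), and the unconditional Kolyvagin-prime dictionary
`zsmul_mem_torsionLocalKer_iff_resTorsion_of_notMem` (`…KolyvaginPrimeDictionary`). The `K`-relation enters as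
the displayed hypothesis `hRel` (Q2's conclusion at `λ`, its two clauses composed); nothing about Q2 is proved
here. THEOREMS ONLY (no definition, no named fact, no `sorry`, standard axioms). BSD is not proved by any of
this.

References: [McCallumLMS1991] §4 Prop. 4.4, Lemma 4.3, §5; [GrossLMS1991] Prop. 6.2, §9; [Kolyvagin1989Izv] §3
(the pair `(E, E^D)` over `ℚ`); [SilvermanAEC2009] X.§4, X.5 Cor. 5.4.
-/

set_option autoImplicit false
set_option linter.dupNamespace false -- tree convention: `Summit.BirchSwinnertonDyer.BirchSwinnertonDyer.Theorems` (summit = sub-problem)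

noncomputable section

open scoped Classical

namespace Summit.BirchSwinnertonDyer.BirchSwinnertonDyer.Theorems.GenusExact.SelmerDescent

open WeierstrassCurve NumberField IsDedekindDomain Field
open Literature.NumberTheory.EllipticCurves Literature.NumberTheory.GaloisRepresentations
open Summit.BirchSwinnertonDyer.BirchSwinnertonDyer.Theorems.GenusExact.FrobeniusCriterion
open Summit.BirchSwinnertonDyer.BirchSwinnertonDyer.Theorems.GenusExact.EigenClassesFinite

variable {K : Type} [Field K] [NumberField K] (W : WeierstrassCurve ℚ) [W.IsElliptic]

/-! ## §1 Multiples: the Selmer condition at a place unramified in `K` transfers `ℚ ⟷ K` -/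

/-- **`c'·x` is Selmer at `v` iff `c'·res x` is Selmer at `w ∣ v`**, for `x ∈ H¹(ℚ, E[n])`, `c' ∈ ℤ`, at an
odd good place `v ∤ c₀ n` of `ℚ` (`K = ℚ(θ₀)` quadratic, `θ₀² = c₀ ∈ ℤ`: `v` is unramified in `K`). (`res` is
additive; `resTorsion_mem_selmerLocalKer` and `mem_selmerLocalKer_of_resTorsion_mem_quadratic`.)
[cite: McCallumLMS1991, §4 Lemma 4.3] -/
theorem zsmul_mem_selmerLocalKer_iff_resTorsion (h2 : Module.finrank ℚ K = 2) {θ₀ : K}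
    (hθ₀ : θ₀ ∉ (algebraMap ℚ K).range) {c₀ : ℤ} (hc₀ : θ₀ ^ 2 = algebraMap ℚ K c₀) (n : ℤ)
    (v : HeightOneSpectrum (𝓞 ℚ)) (w : HeightOneSpectrum (𝓞 K)) [w.asIdeal.LiesOver v.asIdeal]
    (hgood : W.HasGoodReductionAt v) (hn : (n : 𝓞 ℚ) ∉ v.asIdeal) (h2v : (2 : 𝓞 ℚ) ∉ v.asIdeal)
    (hc₀v : ((c₀ : ℤ) : 𝓞 ℚ) ∉ v.asIdeal) (x : galH1Torsion W n) (c' : ℤ) :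
    c' • x ∈ selmerLocalKer W (v.adicCompletion ℚ) n ↔
      c' • resTorsion W K n x ∈ selmerLocalKer (W.baseChange K) (w.adicCompletion K) n := by
  rw [← map_zsmul]
  exact ⟨resTorsion_mem_selmerLocalKer W K v w n hgood hn,
    mem_selmerLocalKer_of_resTorsion_mem_quadratic W h2 hθ₀ hc₀ n v w hgood hn h2v hc₀v⟩

/-! ## §2 Prop. 4.4 over `ℚ` at a Gross–Kolyvagin prime, from the relation over `K` -/

/-- `q = 2^M` is a unit at an odd prime `ℓ ∈ v`: `(q : 𝓞 ℚ) ∉ v`, and `(2 : 𝓞 ℚ) ∉ v`. [folklore] -/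
theorem two_notMem_and_natCast_two_pow_notMem {M q ℓ : ℕ} (hq : q = 2 ^ M) (hℓ : ℓ.Prime) (hℓ2 : ℓ ≠ 2)
    {v : HeightOneSpectrum (𝓞 ℚ)} (hℓv : (ℓ : 𝓞 ℚ) ∈ v.asIdeal) :
    (2 : 𝓞 ℚ) ∉ v.asIdeal ∧ (((q : ℕ) : ℤ) : 𝓞 ℚ) ∉ v.asIdeal := by
  have h2v' : ((2 : ℕ) : 𝓞 ℚ) ∉ v.asIdeal := two_notMem_of_odd_prime_mem hℓ hℓ2 hℓv
  refine ⟨by rwa [Nat.cast_ofNat] at h2v', ?_⟩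
  rw [Int.cast_natCast, hq, Nat.cast_pow]
  exact fun h ↦ h2v' (v.isPrime.mem_of_pow_mem M h)

/-- **Field `c_mem_loc_iff₁₂` — Prop. 4.4 over `ℚ`, even depth `m` → odd depth `ℓm`.** Data: `E = W/ℚ`
elliptic with `Δ(E) < 0`; `K = ℚ(θ₀)` quadratic, `θ₀² = c₀ ∈ ℤ`; twist data `θ ∉ ℚ`, `θ² = c ∈ ℚ` (so
`E^{(c)}_K ≅ E_K`, `hPsiKT`); `q = 2^M`, `M ≥ 1`; `ℓ` an odd prime in `v`, `ℓ ∤ c₀`, `E` and `E^{(c)}` of good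
reduction at `v`, `Frob_ℓ ∼ τ` on `E[q]` (`FrobEqFrobInfty W K q ℓ`), `w ∣ v` of residue degree `2` (inert).
Classes: `c_K, c_K' ∈ H¹(K, E_K[q])` (McCallum's `c_M(m)`, `c_M(ℓm)`), `u ∈ H¹(ℚ, E[q])` with `res u = c_K`,
`y ∈ H¹(ℚ, E^{(c)}[q])` with `hPsiKT (res y) = c_K'`. HYPOTHESIS `hRel` (Q2 = Prop. 4.4 over `K` at `λ = w`,
its two clauses composed): `c'·c_K' ∈ selmerLocalKer_w ⟺ c'·c_K ∈ torsionLocalKer_w`. CONCLUSION: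
**`c'·y ∈ selmerLocalKer_v(E^{(c)}/ℚ) ⟺ c'·u ∈ torsionLocalKer_v(E/ℚ)`**. (§1 for `E^{(c)}`, `hPsiKT` respects
the Selmer condition, `hRel`, and the Kolyvagin-prime dictionary for `E`.) [cite: McCallumLMS1991, §4 Prop. 4.4]
[cite: Kolyvagin1989Izv, §3] -/
theorem zsmul_twist_mem_selmerLocalKer_iff_zsmul_mem_torsionLocalKer_of_K (hΔ : W.Δ < 0) {M : ℕ}
    (hM : 1 ≤ M) {q : ℕ} (hq : q = 2 ^ M) {ℓ : ℕ} (hℓ : ℓ.Prime) (hℓ2 : ℓ ≠ 2)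
    {v : HeightOneSpectrum (𝓞 ℚ)} (hℓv : (ℓ : 𝓞 ℚ) ∈ v.asIdeal) (hgood : W.HasGoodReductionAt v)
    (h2K : Module.finrank ℚ K = 2) {θ₀ : K} (hθ₀ : θ₀ ∉ (algebraMap ℚ K).range) {c₀ : ℤ}
    (hc₀ : θ₀ ^ 2 = algebraMap ℚ K c₀) (hc₀v : ((c₀ : ℤ) : 𝓞 ℚ) ∉ v.asIdeal)
    (hℓM : FrobEqFrobInfty W K q ℓ) (w : HeightOneSpectrum (𝓞 K)) [w.asIdeal.LiesOver v.asIdeal]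
    (hf : w.asIdeal.inertiaDeg (𝓞 ℚ) = 2)
    {θ : K} {c : ℚ} (hθ : θ ∉ Set.range (algebraMap ℚ K)) (hc : θ ^ 2 = algebraMap ℚ K c)
    [(W.quadraticTwist c).IsElliptic] (hgood' : (W.quadraticTwist c).HasGoodReductionAt v)
    {cK cK' : galH1Torsion (W.baseChange K) (q : ℤ)} {u : galH1Torsion W (q : ℤ)}
    {y : galH1Torsion (W.quadraticTwist c) (q : ℤ)} (hu : resTorsion W K (q : ℤ) u = cK)
    (hy : hPsiKT W K hθ hc (q : ℤ) (resTorsion (W.quadraticTwist c) K (q : ℤ) y) = cK') (c' : ℤ)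
    (hRel : c' • cK' ∈ selmerLocalKer (W.baseChange K) (w.adicCompletion K) (q : ℤ) ↔
      c' • cK ∈ (W.baseChange K).torsionLocalKer (w.adicCompletion K) (q : ℤ)) :
    c' • y ∈ selmerLocalKer (W.quadraticTwist c) (v.adicCompletion ℚ) (q : ℤ) ↔
      c' • u ∈ W.torsionLocalKer (v.adicCompletion ℚ) (q : ℤ) := by
  obtain ⟨h2v, hqv⟩ := two_notMem_and_natCast_two_pow_notMem hq hℓ hℓ2 hℓv
  rw [zsmul_mem_selmerLocalKer_iff_resTorsion (W.quadraticTwist c) h2K hθ₀ hc₀ (q : ℤ) v w hgood' hqv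
      h2v hc₀v y c',
    zsmul_mem_selmerLocalKer_iff_hPsiKT_mem W K hθ hc (q : ℤ) (w.adicCompletion K) _ c', hy, hRel, ← hu]
  exact (zsmul_mem_torsionLocalKer_iff_resTorsion_of_notMem W hΔ hM hq hℓ hℓ2 hℓv hgood h2K hθ₀ hc₀
    hc₀v hℓM w hf u c').symm

/-- **Field `c_mem_loc_iff₂₁` — Prop. 4.4 over `ℚ`, odd depth `m` → even depth `ℓm`.** Data as in
`zsmul_twist_mem_selmerLocalKer_iff_zsmul_mem_torsionLocalKer_of_K`, plus, for the twin, `Δ(E^{(c)}) < 0` and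
`Frob_ℓ ∼ τ` on `E^{(c)}[q]` (`FrobEqFrobInfty (W.quadraticTwist c) K q ℓ`; for `c = d_K` both follow from
`E`'s by `…TwinGrossPrimes`). Classes: `u' ∈ H¹(ℚ, E[q])` with `res u' = c_K'` (`= c_M(ℓm)`, even depth),
`y' ∈ H¹(ℚ, E^{(c)}[q])` with `hPsiKT (res y') = c_K` (`= c_M(m)`, odd depth); `hRel` as before. CONCLUSION:
**`c'·u' ∈ selmerLocalKer_v(E/ℚ) ⟺ c'·y' ∈ torsionLocalKer_v(E^{(c)}/ℚ)`**. (§1 for `E`, `hRel`, `hPsiKT`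
respects the strict condition, and the dictionary for `E^{(c)}`.) [cite: McCallumLMS1991, §4 Prop. 4.4]
[cite: Kolyvagin1989Izv, §3] -/
theorem zsmul_mem_selmerLocalKer_iff_zsmul_twist_mem_torsionLocalKer_of_K {M : ℕ} (hM : 1 ≤ M)
    {q : ℕ} (hq : q = 2 ^ M) {ℓ : ℕ} (hℓ : ℓ.Prime) (hℓ2 : ℓ ≠ 2) {v : HeightOneSpectrum (𝓞 ℚ)}
    (hℓv : (ℓ : 𝓞 ℚ) ∈ v.asIdeal) (hgood : W.HasGoodReductionAt v) (h2K : Module.finrank ℚ K = 2)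
    {θ₀ : K} (hθ₀ : θ₀ ∉ (algebraMap ℚ K).range) {c₀ : ℤ} (hc₀ : θ₀ ^ 2 = algebraMap ℚ K c₀)
    (hc₀v : ((c₀ : ℤ) : 𝓞 ℚ) ∉ v.asIdeal) (w : HeightOneSpectrum (𝓞 K))
    [w.asIdeal.LiesOver v.asIdeal] (hf : w.asIdeal.inertiaDeg (𝓞 ℚ) = 2)
    {θ : K} {c : ℚ} (hθ : θ ∉ Set.range (algebraMap ℚ K)) (hc : θ ^ 2 = algebraMap ℚ K c)
    [(W.quadraticTwist c).IsElliptic] (hΔ' : (W.quadraticTwist c).Δ < 0)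
    (hgood' : (W.quadraticTwist c).HasGoodReductionAt v) (hℓM' : FrobEqFrobInfty (W.quadraticTwist c) K q ℓ)
    {cK cK' : galH1Torsion (W.baseChange K) (q : ℤ)} {u' : galH1Torsion W (q : ℤ)}
    {y' : galH1Torsion (W.quadraticTwist c) (q : ℤ)} (hu' : resTorsion W K (q : ℤ) u' = cK')
    (hy' : hPsiKT W K hθ hc (q : ℤ) (resTorsion (W.quadraticTwist c) K (q : ℤ) y') = cK) (c' : ℤ)
    (hRel : c' • cK' ∈ selmerLocalKer (W.baseChange K) (w.adicCompletion K) (q : ℤ) ↔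
      c' • cK ∈ (W.baseChange K).torsionLocalKer (w.adicCompletion K) (q : ℤ)) :
    c' • u' ∈ selmerLocalKer W (v.adicCompletion ℚ) (q : ℤ) ↔
      c' • y' ∈ (W.quadraticTwist c).torsionLocalKer (v.adicCompletion ℚ) (q : ℤ) := by
  obtain ⟨h2v, hqv⟩ := two_notMem_and_natCast_two_pow_notMem hq hℓ hℓ2 hℓv
  rw [zsmul_mem_selmerLocalKer_iff_resTorsion W h2K hθ₀ hc₀ (q : ℤ) v w hgood hqv h2v hc₀v u' c', hu',
    hRel, ← hy', ← zsmul_mem_torsionLocalKer_iff_hPsiKT_mem W K hθ hc (q : ℤ) (w.adicCompletion K) _ c']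
  exact (zsmul_mem_torsionLocalKer_iff_resTorsion_of_notMem (W.quadraticTwist c) hΔ' hM hq hℓ hℓ2 hℓv
    hgood' h2K hθ₀ hc₀ hc₀v hℓM' w hf y' c').symm

end Summit.BirchSwinnertonDyer.BirchSwinnertonDyer.Theorems.GenusExact.SelmerDescent

end
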